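import Mathlib
import Summits.MatrixMultiplication.MatrixMultiplication.Theorems.GradedDesignFamily.Negative.SubfieldCellStructureSliced
import Summits.MatrixMultiplication.MatrixMultiplication.Theorems.GradedDesignFamily.Negative.SubfieldCellExpansion
import Summits.MatrixMultiplication.MatrixMultiplication.Theorems.GradedDesignFamily.Negative.SubfieldCellFootprint
import Summits.MatrixMultiplication.MatrixMultiplication.Theorems.GradedDesignFamily.Negative.SubfieldCellBGTDickson
import Summits.MatrixMultiplication.MatrixMultiplication.Theorems.GradedDesignFamily.Negative.SubfieldCellSlicedEndgame
import Summits.MatrixMultiplication.MatrixMultiplication.Theorems.GradedDesignFamily.Negative.SubfieldCellDetPigeonhole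
import Summits.MatrixMultiplication.MatrixMultiplication.Theorems.GradedDesignFamily.Negative.SubfieldCellSlicedCounting

/-!
# `¬S3` from (BGT) ALONE — Dickson eliminated (route (D′); crux
# `LevelGradedCohnUmans.GradedDesignFamily`, stmt-MatrixMultiplication-7610; negative side,
# line `quadratic-extension-level-one-cell`, unit b2b-lgcu-subfield gen 19)

HONEST FRAMING.  The design stub `stub_subfieldCell` (S3) of the crux is FALSE modulo exactly ONE
published input, Breuillard–Green–Tao for `SL₂` in the form (BGT) [BreuillardGreenTao2011,
Thm 1.3]: gen 18 proved `¬S3 ⇐ (BGT) ∧ (Dickson)` (`not_subfieldCell_of_BGT_Dickson`); here the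
hypothesis (Dickson) — "a proper subgroup of `SL₂(K)` of order `≫ |K|²` fixes a line" — is
REMOVED: in the non-generating case the approximate group controls `φ(SL₂ k)·Y`, a dense piece of
`φ(SL₂ k)` conjugates into the generated proper subgroup, and the in-tree elementary facts
(bounded-index subgroups of `SL₂(k)` are everything, the normal form of `φ`, overgroups of
`SL₂(k)` in `SL₂(K)` for `[K:k] = 2`) force generation (`structureSliced_of_pieces`).  This file:
`footprintExpansion_of_sliced` = the footprint-expansion composition fed by the sliced conclusion
(S′) only (the Borel branch of `footprintExpansion_of_structure` disappears), and the capstone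
`not_subfieldCell_of_BGT`.  A NEGATIVE decision of the stub modulo (BGT); NOT summit progress.

Sorry-free. [folklore]
-/

set_option linter.dupNamespace false

noncomputable section

open scoped BigOperators Pointwise

namespace Summit.MatrixMultiplication.MatrixMultiplication.Theorems.GradedDesignFamily.Negative

/-- **FOOTPRINT EXPANSION from (T), (S′), (E1)** — as `footprintExpansion_of_structure`, with the
structure dichotomy (S) replaced by its Dickson-free sliced form (S′) (which sees `φ`, `X`, `Y`).
NOT summit progress. [cite: Tao2006, Thm 4.6; BreuillardGreenTao2011, Thm 1.3] -/
theorem footprintExpansion_of_sliced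
    (hT : ∃ M : ℝ → ℝ, ∀ K₀ : ℝ, 1 ≤ K₀ → 1 ≤ M K₀ ∧
      ∀ (G : Type) [Group G] [DecidableEq G] (A B : Finset G), A.Nonempty → B.Nonempty →
        ((A * B).card : ℝ) ≤ K₀ * Real.sqrt ((A.card : ℝ) * B.card) →
        ∃ H X : Finset G, IsApproximateSubgroup (M K₀) (H : Set G) ∧ (X.card : ℝ) ≤ M K₀ ∧
          (H.card : ℝ) ≤ M K₀ * Real.sqrt ((A.card : ℝ) * B.card) ∧ A ⊆ X * H ∧ B ⊆ H * X)
    (hS : ∀ M c₁ c₂ : ℝ, 1 ≤ M → 0 < c₁ → 0 < c₂ → ∃ m₀ Q₂ : ℕ,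
      ∀ (k K : Type) [Field k] [Fintype k] [DecidableEq k] [Field K] [Fintype K] [DecidableEq K]
        (φ : Matrix.SpecialLinearGroup (Fin 2) k →* Matrix.GeneralLinearGroup (Fin 2) K),
        Function.Injective φ → Fintype.card K = Fintype.card k ^ 2 → Q₂ ≤ Fintype.card K →
        ∀ A X Y : Finset (Matrix.GeneralLinearGroup (Fin 2) K),
          IsApproximateSubgroup M (A : Set (Matrix.GeneralLinearGroup (Fin 2) K)) →
          c₁ * (Fintype.card K : ℝ) ^ 3 ≤ A.card → (A.card : ℝ) ≤ c₂ * (Fintype.card K : ℝ) ^ 3 →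
          (X.card : ℝ) ≤ M → Y.Nonempty → Finset.univ.image φ * Y ⊆ X * A →
          (A.image Matrix.GeneralLinearGroup.det).card ≤ m₀)
    (hE1 : ∀ c : ℝ, 0 < c → ∀ m : ℕ, ∃ Q₃ : ℕ, ∀ (k K : Type) [Field k] [Fintype k] [DecidableEq k]
      [Field K] [Fintype K] [DecidableEq K]
      (φ : Matrix.SpecialLinearGroup (Fin 2) k →* Matrix.GeneralLinearGroup (Fin 2) K),
      Function.Injective φ → Fintype.card K = Fintype.card k ^ 2 → Q₃ ≤ Fintype.card K →
      ∀ Y Z : Finset (Matrix.GeneralLinearGroup (Fin 2) K),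
        c * (Fintype.card K : ℝ) ^ (3 / 2 : ℝ) ≤ (Finset.univ.image φ).card →
        c * (Fintype.card K : ℝ) ^ (3 / 2 : ℝ) ≤ Y.card →
        c * (Fintype.card K : ℝ) ^ (3 / 2 : ℝ) ≤ Z.card →
        Literature.Combinatorics.Additive.TripleProductProperty (Finset.univ.image φ) Y Z →
        (Y.image Matrix.GeneralLinearGroup.det).card ≤ m →
        (Z.image Matrix.GeneralLinearGroup.det).card ≤ m → False) :
    ∀ c C : ℝ, 0 < c → 0 < C → ∃ Q₁ : ℕ, ∀ (k K : Type) [Field k] [Fintype k] [DecidableEq k]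
      [Field K] [Fintype K] [DecidableEq K]
      (φ : Matrix.SpecialLinearGroup (Fin 2) k →* Matrix.GeneralLinearGroup (Fin 2) K),
      Function.Injective φ → Fintype.card K = Fintype.card k ^ 2 → Q₁ ≤ Fintype.card K →
      ∀ Y Z : Finset (Matrix.GeneralLinearGroup (Fin 2) K),
        c * (Fintype.card K : ℝ) ^ (3 / 2 : ℝ) ≤ (Finset.univ.image φ).card →
        c * (Fintype.card K : ℝ) ^ (3 / 2 : ℝ) ≤ Y.card →
        c * (Fintype.card K : ℝ) ^ (3 / 2 : ℝ) ≤ Z.card →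
        Literature.Combinatorics.Additive.TripleProductProperty (Finset.univ.image φ) Y Z →
        C * (Fintype.card K : ℝ) ^ 3 < ((Finset.univ.image φ * Y * Y⁻¹ * Z).card : ℝ) := by
  intro c C hc hC
  -- constants
  obtain ⟨Mf, hMf⟩ := hT
  set K₀ : ℝ := max 1 (C / c ^ 2) with hK₀def
  have hK₀1 : 1 ≤ K₀ := le_max_left _ _
  obtain ⟨hM1, hTao⟩ := hMf K₀ hK₀1
  set M : ℝ := Mf K₀ with hMdef
  have hM0 : 0 < M := by linarith
  obtain ⟨m₀, Q₂, hS'⟩ := hS M (c ^ 2 / M) (M * C) hM1 (by positivity) (by positivity)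
  obtain ⟨Q₃, hE1'⟩ := hE1 c hc (⌊M⌋₊ * m₀)
  refine ⟨max Q₂ Q₃, ?_⟩
  intro k K _ _ _ _ _ _ φ hφ hK hQ Y Z hH hY hZ htpp
  have hQ2 : Q₂ ≤ Fintype.card K := (le_max_left _ _).trans hQ
  have hQ3 : Q₃ ≤ Fintype.card K := (le_max_right _ _).trans hQ
  by_contra hP
  rw [not_lt] at hP
  -- basic sizes
  have hQ1 : (1 : ℝ) ≤ (Fintype.card K : ℝ) := Nat.one_le_cast.2 Fintype.card_pos
  have hQ0 : (0 : ℝ) < (Fintype.card K : ℝ) := by linarith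
  have hspos : (0 : ℝ) < (Fintype.card K : ℝ) ^ (3 / 2 : ℝ) := Real.rpow_pos_of_pos hQ0 _
  have hs2 : ((Fintype.card K : ℝ) ^ (3 / 2 : ℝ)) ^ 2 = (Fintype.card K : ℝ) ^ 3 := by
    rw [sq, ← Real.rpow_add hQ0]
    norm_num
  have hYne : Y.Nonempty := by
    rw [← Finset.card_pos]
    have : (0 : ℝ) < Y.card := lt_of_lt_of_le (mul_pos hc hspos) hY
    exact_mod_cast this
  have hZne : Z.Nonempty := by
    rw [← Finset.card_pos]
    have : (0 : ℝ) < Z.card := lt_of_lt_of_le (mul_pos hc hspos) hZ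
    exact_mod_cast this
  have h1H : (1 : Matrix.GeneralLinearGroup (Fin 2) K) ∈ Finset.univ.image φ :=
    Finset.mem_image.2 ⟨1, Finset.mem_univ _, map_one φ⟩
  have hAne : (Finset.univ.image φ * Y).Nonempty := Finset.Nonempty.mul ⟨1, h1H⟩ hYne
  have hBne : (Y⁻¹ * Z).Nonempty := Finset.Nonempty.mul hYne.inv hZne
  -- the balanced factorisation: both factors have size `≥ c² Q³`
  have hAcard : ((Finset.univ.image φ * Y).card : ℝ) = ((Finset.univ.image φ).card : ℝ) * Y.card := by
    exact_mod_cast subfieldCell_card_imageMulY φ hφ Y Z htpp hZne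
  have hBcard : ((Y⁻¹ * Z).card : ℝ) = (Y.card : ℝ) * Z.card := by
    exact_mod_cast subfieldCell_card_invYMulZ φ Y Z htpp
  have hprod : ∀ a b : ℝ, c * (Fintype.card K : ℝ) ^ (3 / 2 : ℝ) ≤ a →
      c * (Fintype.card K : ℝ) ^ (3 / 2 : ℝ) ≤ b → c ^ 2 * (Fintype.card K : ℝ) ^ 3 ≤ a * b := by
    intro a b ha hb
    have h := mul_le_mul ha hb (by positivity) ((mul_pos hc hspos).le.trans ha)
    calc c ^ 2 * (Fintype.card K : ℝ) ^ 3
        = c * (Fintype.card K : ℝ) ^ (3 / 2 : ℝ) * (c * (Fintype.card K : ℝ) ^ (3 / 2 : ℝ)) := by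
          rw [← hs2]; ring
      _ ≤ a * b := h
  have hAlo : c ^ 2 * (Fintype.card K : ℝ) ^ 3 ≤ (Finset.univ.image φ * Y).card := by
    rw [hAcard]; exact hprod _ _ hH hY
  have hBlo : c ^ 2 * (Fintype.card K : ℝ) ^ 3 ≤ (Y⁻¹ * Z).card := by
    rw [hBcard]; exact hprod _ _ hY hZ
  have hAB : Finset.univ.image φ * Y * (Y⁻¹ * Z) = Finset.univ.image φ * Y * Y⁻¹ * Z :=
    (mul_assoc _ _ _).symm
  have hABcard : ((Finset.univ.image φ * Y * (Y⁻¹ * Z)).card : ℝ) ≤ C * (Fintype.card K : ℝ) ^ 3 := by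
    rw [hAB]; exact hP
  have hc2Q : (0 : ℝ) ≤ c ^ 2 * (Fintype.card K : ℝ) ^ 3 := by positivity
  have hsqrt_lo : c ^ 2 * (Fintype.card K : ℝ) ^ 3 ≤
      Real.sqrt (((Finset.univ.image φ * Y).card : ℝ) * (Y⁻¹ * Z).card) := by
    apply Real.le_sqrt_of_sq_le
    rw [sq]
    exact mul_le_mul hAlo hBlo hc2Q (Nat.cast_nonneg _)
  have hA_le : ((Finset.univ.image φ * Y).card : ℝ) ≤ C * (Fintype.card K : ℝ) ^ 3 :=
    le_trans (by exact_mod_cast Finset.card_le_card_mul_right hBne) hABcard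
  have hB_le : ((Y⁻¹ * Z).card : ℝ) ≤ C * (Fintype.card K : ℝ) ^ 3 :=
    le_trans (by exact_mod_cast Finset.card_le_card_mul_left hAne) hABcard
  have hsqrt_hi : Real.sqrt (((Finset.univ.image φ * Y).card : ℝ) * (Y⁻¹ * Z).card) ≤
      C * (Fintype.card K : ℝ) ^ 3 := by
    calc Real.sqrt (((Finset.univ.image φ * Y).card : ℝ) * (Y⁻¹ * Z).card)
        ≤ Real.sqrt ((C * (Fintype.card K : ℝ) ^ 3) ^ 2) := by
          apply Real.sqrt_le_sqrt
          rw [sq]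
          exact mul_le_mul hA_le hB_le (Nat.cast_nonneg _) (by positivity)
      _ = C * (Fintype.card K : ℝ) ^ 3 := Real.sqrt_sq (by positivity)
  -- small doubling: `|A·B| ≤ K₀ (|A||B|)^{1/2}`
  have hdoub : ((Finset.univ.image φ * Y * (Y⁻¹ * Z)).card : ℝ) ≤
      K₀ * Real.sqrt (((Finset.univ.image φ * Y).card : ℝ) * (Y⁻¹ * Z).card) := by
    calc ((Finset.univ.image φ * Y * (Y⁻¹ * Z)).card : ℝ) ≤ C * (Fintype.card K : ℝ) ^ 3 := hABcard
      _ = C / c ^ 2 * (c ^ 2 * (Fintype.card K : ℝ) ^ 3) := by field_simp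
      _ ≤ K₀ * Real.sqrt (((Finset.univ.image φ * Y).card : ℝ) * (Y⁻¹ * Z).card) :=
          mul_le_mul (le_max_right _ _) hsqrt_lo hc2Q (by positivity)
  -- (T): the approximate group
  obtain ⟨𝓗, X, happ, hX, h𝓗hi, hAsub, hBsub⟩ :=
    hTao (Matrix.GeneralLinearGroup (Fin 2) K) (Finset.univ.image φ * Y) (Y⁻¹ * Z) hAne hBne hdoub
  have h𝓗lo : c ^ 2 / M * (Fintype.card K : ℝ) ^ 3 ≤ 𝓗.card := by
    have h1 : ((Finset.univ.image φ * Y).card : ℝ) ≤ (X * 𝓗).card := by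
      exact_mod_cast Finset.card_le_card hAsub
    have h2 : ((X * 𝓗).card : ℝ) ≤ (X.card : ℝ) * 𝓗.card := by exact_mod_cast Finset.card_mul_le
    have h3 : (X.card : ℝ) * 𝓗.card ≤ M * 𝓗.card := mul_le_mul_of_nonneg_right hX (Nat.cast_nonneg _)
    rw [div_mul_eq_mul_div, div_le_iff₀ hM0]
    linarith
  have h𝓗hi' : (𝓗.card : ℝ) ≤ M * C * (Fintype.card K : ℝ) ^ 3 := by
    calc (𝓗.card : ℝ) ≤ M * Real.sqrt (((Finset.univ.image φ * Y).card : ℝ) * (Y⁻¹ * Z).card) := h𝓗hi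
      _ ≤ M * (C * (Fintype.card K : ℝ) ^ 3) := mul_le_mul_of_nonneg_left hsqrt_hi hM0.le
      _ = M * C * (Fintype.card K : ℝ) ^ 3 := by ring
  have hXn : X.card ≤ ⌊M⌋₊ := Nat.le_floor hX
  obtain ⟨y₁, hy₁⟩ := hYne
  -- (S′): few determinant values on `𝓗`, hence on `Y` and `Z`; then (E1)
  have hdet := hS' k K φ hφ hK hQ2 𝓗 X Y happ h𝓗lo h𝓗hi' hX ⟨y₁, hy₁⟩ hAsub
  have hYdet : (Y.image Matrix.GeneralLinearGroup.det).card ≤ ⌊M⌋₊ * m₀ := by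
    have hsub : Y.image Matrix.GeneralLinearGroup.det ⊆
        X.image Matrix.GeneralLinearGroup.det * 𝓗.image Matrix.GeneralLinearGroup.det := by
      rw [← Finset.image_mul]
      exact Finset.image_subset_image
        ((Finset.subset_mul_right Y h1H).trans hAsub)
    calc (Y.image Matrix.GeneralLinearGroup.det).card
        ≤ (X.image Matrix.GeneralLinearGroup.det * 𝓗.image Matrix.GeneralLinearGroup.det).card :=
          Finset.card_le_card hsub
      _ ≤ (X.image Matrix.GeneralLinearGroup.det).card *
            (𝓗.image Matrix.GeneralLinearGroup.det).card := Finset.card_mul_le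
      _ ≤ ⌊M⌋₊ * m₀ := Nat.mul_le_mul (Finset.card_image_le.trans hXn) hdet
  have hZdet : (Z.image Matrix.GeneralLinearGroup.det).card ≤ ⌊M⌋₊ * m₀ := by
    have hsub : Z.image Matrix.GeneralLinearGroup.det ⊆
        Matrix.GeneralLinearGroup.det y₁ •
          (𝓗.image Matrix.GeneralLinearGroup.det * X.image Matrix.GeneralLinearGroup.det) := by
      intro d hd
      obtain ⟨z, hz, rfl⟩ := Finset.mem_image.1 hd
      have hmem : y₁⁻¹ * z ∈ 𝓗 * X := hBsub (Finset.mul_mem_mul (Finset.inv_mem_inv hy₁) hz)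
      rw [← Finset.image_mul]
      refine Finset.mem_smul_finset.2 ⟨Matrix.GeneralLinearGroup.det (y₁⁻¹ * z),
        Finset.mem_image_of_mem _ hmem, ?_⟩
      rw [smul_eq_mul, ← map_mul, mul_inv_cancel_left]
    calc (Z.image Matrix.GeneralLinearGroup.det).card
        ≤ (Matrix.GeneralLinearGroup.det y₁ •
            (𝓗.image Matrix.GeneralLinearGroup.det * X.image Matrix.GeneralLinearGroup.det)).card :=
          Finset.card_le_card hsub
      _ = (𝓗.image Matrix.GeneralLinearGroup.det * X.image Matrix.GeneralLinearGroup.det).card :=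
          Finset.card_smul_finset _ _
      _ ≤ (𝓗.image Matrix.GeneralLinearGroup.det).card *
            (X.image Matrix.GeneralLinearGroup.det).card := Finset.card_mul_le
      _ ≤ m₀ * ⌊M⌋₊ := Nat.mul_le_mul hdet (Finset.card_image_le.trans hXn)
      _ = ⌊M⌋₊ * m₀ := Nat.mul_comm _ _
  exact hE1' k K φ hφ hK hQ3 Y Z hH hY hZ htpp hYdet hZdet

/-- **`¬S3` from (BGT) alone.**  The design stub `stub_subfieldCell` (S3, spelled verbatim in
tree-only vocabulary) is FALSE modulo Breuillard–Green–Tao for `SL₂` [BreuillardGreenTao2011,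
Thm 1.3]; Tao's product-set theorem, the sliced counting/endgame, and — new in gen 19 — the
replacement of Dickson's classification are all proved in-tree.  NOT summit progress. [folklore] -/
theorem not_subfieldCell_of_BGT
    (hBGT : ∃ C : ℝ → ℝ, ∀ K₀ : ℝ, 1 ≤ C K₀ ∧
      ∀ (K : Type) [Field K] [Fintype K] [DecidableEq K]
        (B : Finset (Matrix.GeneralLinearGroup (Fin 2) K)),
        (∀ b ∈ B, Matrix.GeneralLinearGroup.det b = 1) →
        IsApproximateSubgroup K₀ (B : Set (Matrix.GeneralLinearGroup (Fin 2) K)) →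
        Subgroup.closure (B : Set (Matrix.GeneralLinearGroup (Fin 2) K)) =
          (Matrix.GeneralLinearGroup.det : Matrix.GeneralLinearGroup (Fin 2) K →* Kˣ).ker →
        (B.card : ℝ) ≤ C K₀ ∨
          (Nat.card (Matrix.GeneralLinearGroup.det :
              Matrix.GeneralLinearGroup (Fin 2) K →* Kˣ).ker : ℝ) ≤ C K₀ * B.card) :
    ¬ (∃ c : ℝ, 0 < c ∧ ∀ N : ℕ, ∃ (k K : Type) (_ : Field k) (_ : Fintype k) (_ : DecidableEq k)
      (_ : Field K) (_ : Fintype K) (_ : DecidableEq K)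
      (φ : Matrix.SpecialLinearGroup (Fin 2) k →* Matrix.GeneralLinearGroup (Fin 2) K),
      Function.Injective φ ∧ Fintype.card K = Fintype.card k ^ 2 ∧ N ≤ Fintype.card K ∧
      ∃ Y Z : Finset (Matrix.GeneralLinearGroup (Fin 2) K),
        c * (Fintype.card K : ℝ) ^ (3 / 2 : ℝ) ≤ (Finset.univ.image φ).card ∧
        c * (Fintype.card K : ℝ) ^ (3 / 2 : ℝ) ≤ Y.card ∧
        c * (Fintype.card K : ℝ) ^ (3 / 2 : ℝ) ≤ Z.card ∧
        ∀ z₀ ∈ Z, ∃ cf : (Fin 2 → K) → (Fin 2 → K) → ℂ,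
          ∀ a : Matrix.SpecialLinearGroup (Fin 2) k, ∀ y ∈ Y, ∀ y' ∈ Y, ∀ z ∈ Z,
            (∑ u : Fin 2 → K, cf u (((φ a * y * y'⁻¹ * z : Matrix.GeneralLinearGroup (Fin 2) K) :
                Matrix (Fin 2) (Fin 2) K).mulVec u)) =
              if a = 1 ∧ y = y' ∧ z = z₀ then 1 else 0) :=
  not_subfieldCell_of_footprintExpansion
    (footprintExpansion_of_sliced taoProductSet
      (structureSliced_of_pieces subfieldCell_detPigeonhole hBGT subfieldCell_slicedCounting)
      subfieldCell_slicedEndgame)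

end Summit.MatrixMultiplication.MatrixMultiplication.Theorems.GradedDesignFamily.Negative

end
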